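import Literature.Probability.RandomPlanarGeometry.HexSAWLattice
import Literature.Probability.RandomPlanarGeometry.HexParafermionProofs
import HarnessLib

/-!
# Negative knowledge on crux `BoundaryClosure` — the corridor refutation of `HexObservableLimit`, part 4: coordinates `fj j r` on the faces of the honeycomb lattice, adjacency and centres in coordinates, reachability toolkit in induced subgraphs.

Support for `SAWDefectDecoherenceHexObservableLimitRefutation.lean` (item stmt-CriticalPhenomena-5420, the conclusion of
crux `BoundaryClosure`, stmt-CriticalPhenomena-8536). Everything proved. [folklore]
-/

noncomputable section

open Set Filter Topology
open Literature.Probability.RandomPlanarGeometry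
open Literature.Probability.LatticeModels Literature.Probability.RandomPlanarGeometry.SAW

namespace Summit.CriticalPhenomena.SAWScalingLimit.Theorems.BoundaryClosure.Negative

/-! ### Coordinates -/

/-- The face of the honeycomb lattice with row `r` and row-order index `j`: cell `x₀ = ⌊j/2⌋`,
type `j mod 2` (`0` = up triangle, `1` = down triangle). [folklore] -/
def fj (j r : ℤ) : HexVertex := (![j / 2, r], if j % 2 = 0 then 0 else 1)

/-- First cell coordinate of `fj`. [folklore] -/
@[simp] theorem fj_fst_zero (j r : ℤ) : (fj j r).1 0 = j / 2 := by simp [fj]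

/-- Row coordinate of `fj`. [folklore] -/
@[simp] theorem fj_fst_one (j r : ℤ) : (fj j r).1 1 = r := by simp [fj]

/-- Type of `fj` for even index. [folklore] -/
theorem fj_snd_of_even {j : ℤ} (h : j % 2 = 0) (r : ℤ) : (fj j r).2 = 0 := by simp [fj, h]

/-- Type of `fj` for odd index. [folklore] -/
theorem fj_snd_of_odd {j : ℤ} (h : j % 2 = 1) (r : ℤ) : (fj j r).2 = 1 := by simp [fj, h]

/-- Every face has coordinates: `v = fj (2 x₀ + k) x₁`. [folklore] -/
theorem eq_fj (v : HexVertex) : v = fj (2 * v.1 0 + (v.2 : ℕ)) (v.1 1) := by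
  obtain ⟨x, k⟩ := v
  refine Prod.ext ?_ ?_
  · funext i
    fin_cases i
    · fin_cases k
      · simp [fj]
      · simp [fj]; omega
    · simp [fj]
  · fin_cases k
    · simp [fj]
    · simp [fj]

/-- `fj` is injective. [folklore] -/
theorem fj_inj {j r j' r' : ℤ} : fj j r = fj j' r' ↔ j = j' ∧ r = r' := by
  constructor
  · intro h
    have h0 := congrArg (fun v : HexVertex => v.1 0) h
    have h1 := congrArg (fun v : HexVertex => v.1 1) h
    have h2 := congrArg (fun v : HexVertex => v.2) h
    simp only [fj_fst_zero, fj_fst_one] at h0 h1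
    simp only [fj] at h2
    refine ⟨?_, h1⟩
    rcases Int.emod_two_eq_zero_or_one j with hj | hj <;>
      rcases Int.emod_two_eq_zero_or_one j' with hj' | hj' <;> simp [hj, hj'] at h2 <;> omega
  · rintro ⟨rfl, rfl⟩; rfl

/-- **Adjacency of `hexGraph` in `(j, r)` coordinates**: row-neighbours `j ± 1`, and the vertical
edge from an up triangle (`j` even) down to the down triangle `(j + 1, r - 1)`. [folklore] -/
theorem adj_fj_iff (j r j' r' : ℤ) :
    hexGraph.Adj (fj j r) (fj j' r') ↔
      (r' = r ∧ (j' = j + 1 ∨ j = j' + 1)) ∨ (j % 2 = 0 ∧ r' = r - 1 ∧ j' = j + 1) ∨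
        (j % 2 = 1 ∧ r' = r + 1 ∧ j = j' + 1) := by
  unfold fj
  rcases Int.emod_two_eq_zero_or_one j with hj | hj <;>
    rcases Int.emod_two_eq_zero_or_one j' with hj' | hj' <;>
    simp only [hj, hj', if_true, hexGraph_adj_iff_coord, Matrix.cons_val_zero,
      Matrix.cons_val_one] <;> simp <;> omega

/-- Row neighbours are adjacent. [folklore] -/
theorem adj_fj_succ (j r : ℤ) : hexGraph.Adj (fj j r) (fj (j + 1) r) :=
  (adj_fj_iff _ _ _ _).2 (Or.inl ⟨rfl, Or.inl rfl⟩)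

/-- The vertical edge below an up triangle. [folklore] -/
theorem adj_fj_down {j : ℤ} (hj : j % 2 = 0) (r : ℤ) : hexGraph.Adj (fj j r) (fj (j + 1) (r - 1)) :=
  (adj_fj_iff _ _ _ _).2 (Or.inr (Or.inl ⟨hj, rfl, rfl⟩))

/-- The vertical edge above a down triangle. [folklore] -/
theorem adj_fj_up {j : ℤ} (hj : j % 2 = 1) (r : ℤ) : hexGraph.Adj (fj j r) (fj (j - 1) (r + 1)) :=
  (adj_fj_iff _ _ _ _).2 (Or.inr (Or.inr ⟨hj, rfl, by ring⟩))

/-! ### Face centres in coordinates -/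

/-- Real part of a face centre. [folklore] -/
theorem hexCenter_re' (x : Site 2) (t : Fin 2) :
    (hexCenter (x, t)).re = x 0 + (x 1 : ℝ) / 2 + ((t : ℕ) + 1) / 2 := by
  simp [hexCenter, triEmbed, triZeta_re, triZeta_im]; ring

/-- Imaginary part of a face centre. [folklore] -/
theorem hexCenter_im' (x : Site 2) (t : Fin 2) :
    (hexCenter (x, t)).im = ((x 1 : ℝ) + ((t : ℕ) + 1) / 3) * (Real.sqrt 3 / 2) := by
  simp [hexCenter, triEmbed, triZeta_re, triZeta_im]; ring

/-- The abscissa of `fj j r` is `(j + r + 1)/2`. [folklore] -/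
theorem re_hexCenter_fj (j r : ℤ) : (hexCenter (fj j r)).re = ((j : ℝ) + r + 1) / 2 := by
  have hdecomp : ((j : ℤ) : ℝ) = 2 * ((j / 2 : ℤ) : ℝ) + ((j % 2 : ℤ) : ℝ) := by
    have : j = 2 * (j / 2) + j % 2 := by omega
    exact_mod_cast this
  unfold fj
  rcases Int.emod_two_eq_zero_or_one j with hj | hj
  · rw [if_pos hj, hexCenter_re']
    simp only [Matrix.cons_val_zero, Matrix.cons_val_one, Fin.val_zero,
      CharP.cast_eq_zero, zero_add]
    rw [hj] at hdecomp; push_cast at hdecomp; linarith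
  · rw [if_neg (by omega), hexCenter_re']
    simp only [Matrix.cons_val_zero, Matrix.cons_val_one, Fin.val_one,
      Nat.cast_one]
    rw [hj] at hdecomp; push_cast at hdecomp; linarith

/-- The height of `fj j r` is `(√3/2)(r + (j mod 2 + 1)/3)`. [folklore] -/
theorem im_hexCenter_fj (j r : ℤ) :
    (hexCenter (fj j r)).im = ((r : ℝ) + (((j % 2 : ℤ) : ℝ) + 1) / 3) * (Real.sqrt 3 / 2) := by
  unfold fj
  rcases Int.emod_two_eq_zero_or_one j with hj | hj
  · rw [if_pos hj, hexCenter_im']; simp [hj]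
  · rw [if_neg (by omega), hexCenter_im']; simp [hj]

/-- Height bounds of a face in row `r`: between `(√3/2)(r + 1/3)` and `(√3/2)(r + 2/3)`. [folklore] -/
theorem im_hexCenter_fj_bounds (j r : ℤ) :
    ((r : ℝ) + 1 / 3) * (Real.sqrt 3 / 2) ≤ (hexCenter (fj j r)).im ∧
      (hexCenter (fj j r)).im ≤ ((r : ℝ) + 2 / 3) * (Real.sqrt 3 / 2) := by
  rw [im_hexCenter_fj]
  have hs : 0 ≤ Real.sqrt 3 / 2 := by positivity
  rcases Int.emod_two_eq_zero_or_one j with hj | hj <;> rw [hj] <;> push_cast <;>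
    constructor <;> nlinarith

/-! ### Reachability toolkit in induced subgraphs -/

section Reach

variable (S : Set HexVertex)

/-- Adjacent members of `S` are reachable in the induced subgraph. [folklore] -/
theorem reach_of_adj {u v : HexVertex} (hu : u ∈ S) (hv : v ∈ S) (h : hexGraph.Adj u v) :
    (hexGraph.induce S).Reachable ⟨u, hu⟩ ⟨v, hv⟩ :=
  SimpleGraph.Adj.reachable (by simpa [SimpleGraph.induce_adj] using h)

/-- **Row paths**: if all faces of row `r` with indices in `[j, j + n]` lie in `S`, the two end faces
are reachable from each other inside `S`. [folklore] -/
theorem reach_row (r j : ℤ) (n : ℕ) (h : ∀ i : ℤ, j ≤ i → i ≤ j + n → fj i r ∈ S) :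
    (hexGraph.induce S).Reachable ⟨fj j r, h j le_rfl (by omega)⟩
      ⟨fj (j + n) r, h (j + n) (by omega) le_rfl⟩ := by
  induction n with
  | zero => simp only [Nat.cast_zero, add_zero]; rfl
  | succ n ih =>
    have h' : ∀ i : ℤ, j ≤ i → i ≤ j + n → fj i r ∈ S := fun i hi hi' => h i hi (by push_cast; omega)
    refine (ih h').trans ?_
    have hm1 : fj (j + n) r ∈ S := h _ (by omega) (by push_cast; omega)
    have hm2 : fj (j + n + 1) r ∈ S := h _ (by omega) (by push_cast; omega)
    have e : fj (j + (n + 1 : ℕ)) r = fj (j + n + 1) r := by push_cast; ring_nf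
    rw [show (⟨fj (j + (n + 1 : ℕ)) r, h _ (by omega) le_rfl⟩ : S) =
      ⟨fj (j + n + 1) r, hm2⟩ from Subtype.ext e]
    exact reach_of_adj S hm1 hm2 (adj_fj_succ _ _)

/-- Row paths between any two indices `j₁ ≤ j₂`. [folklore] -/
theorem reach_row' (r j₁ j₂ : ℤ) (hle : j₁ ≤ j₂) (h : ∀ i : ℤ, j₁ ≤ i → i ≤ j₂ → fj i r ∈ S) :
    (hexGraph.induce S).Reachable ⟨fj j₁ r, h j₁ le_rfl hle⟩ ⟨fj j₂ r, h j₂ hle le_rfl⟩ := by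
  obtain ⟨n, rfl⟩ : ∃ n : ℕ, j₂ = j₁ + n := ⟨(j₂ - j₁).toNat, by omega⟩
  exact reach_row S r j₁ n h

/-- **Downward columns**: from an up triangle `(j, r)` (`j` even) down `n` rows, through the faces
`(j+1, r-i)`, `(j, r-i)`, `1 ≤ i ≤ n`. [folklore] -/
theorem reach_col_down {j : ℤ} (hj : j % 2 = 0) (r : ℤ) (n : ℕ) (h0 : fj j r ∈ S)
    (h : ∀ i : ℤ, 1 ≤ i → i ≤ n → fj j (r - i) ∈ S ∧ fj (j + 1) (r - i) ∈ S) :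
    (hexGraph.induce S).Reachable ⟨fj j r, h0⟩
      ⟨fj j (r - n), by
        rcases Nat.eq_zero_or_pos n with rfl | hn
        · simpa using h0
        · exact (h n (by exact_mod_cast hn) le_rfl).1⟩ := by
  induction n with
  | zero => simp only [Nat.cast_zero, sub_zero]; rfl
  | succ n ih =>
    have h' : ∀ i : ℤ, 1 ≤ i → i ≤ n → fj j (r - i) ∈ S ∧ fj (j + 1) (r - i) ∈ S :=
      fun i hi hi' => h i hi (by push_cast; omega)
    refine (ih h').trans ?_
    have hA := (h (n + 1) (by omega) (by push_cast; omega))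
    -- (j, r-n) → (j+1, r-n-1) → (j, r-n-1)
    have e1 : fj (j + 1) (r - n - 1) ∈ S := by have := hA.2; rwa [sub_sub]
    have e2 : fj j (r - n - 1) ∈ S := by have := hA.1; rwa [sub_sub]
    have hmid : fj j (r - n) ∈ S := by
      rcases Nat.eq_zero_or_pos n with rfl | hn
      · simpa using h0
      · exact (h' n (by exact_mod_cast hn) le_rfl).1
    have step1 : (hexGraph.induce S).Reachable ⟨fj j (r - n), hmid⟩ ⟨fj (j + 1) (r - n - 1), e1⟩ :=
      reach_of_adj S hmid e1 (by simpa [sub_sub] using adj_fj_down hj (r - n))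
    have step2 : (hexGraph.induce S).Reachable ⟨fj (j + 1) (r - n - 1), e1⟩ ⟨fj j (r - n - 1), e2⟩ :=
      (reach_of_adj S e2 e1 (adj_fj_succ _ _)).symm
    have e : fj j (r - (n + 1 : ℕ)) = fj j (r - n - 1) := by push_cast; rw [sub_sub]
    rw [show (⟨fj j (r - (n + 1 : ℕ)), _⟩ : S) = ⟨fj j (r - n - 1), e2⟩ from Subtype.ext e]
    exact step1.trans step2

/-- **Upward columns**: from a down triangle `(j, r)` (`j` odd) up `n` rows, through the faces
`(j-1, r+i)`, `(j, r+i)`, `1 ≤ i ≤ n`. [folklore] -/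
theorem reach_col_up {j : ℤ} (hj : j % 2 = 1) (r : ℤ) (n : ℕ) (h0 : fj j r ∈ S)
    (h : ∀ i : ℤ, 1 ≤ i → i ≤ n → fj j (r + i) ∈ S ∧ fj (j - 1) (r + i) ∈ S) :
    (hexGraph.induce S).Reachable ⟨fj j r, h0⟩
      ⟨fj j (r + n), by
        rcases Nat.eq_zero_or_pos n with rfl | hn
        · simpa using h0
        · exact (h n (by exact_mod_cast hn) le_rfl).1⟩ := by
  induction n with
  | zero => simp only [Nat.cast_zero, add_zero]; rfl
  | succ n ih =>
    have h' : ∀ i : ℤ, 1 ≤ i → i ≤ n → fj j (r + i) ∈ S ∧ fj (j - 1) (r + i) ∈ S :=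
      fun i hi hi' => h i hi (by push_cast; omega)
    refine (ih h').trans ?_
    have hA := (h (n + 1) (by omega) (by push_cast; omega))
    have e1 : fj (j - 1) (r + n + 1) ∈ S := by have := hA.2; rwa [add_assoc]
    have e2 : fj j (r + n + 1) ∈ S := by have := hA.1; rwa [add_assoc]
    have hmid : fj j (r + n) ∈ S := by
      rcases Nat.eq_zero_or_pos n with rfl | hn
      · simpa using h0
      · exact (h' n (by exact_mod_cast hn) le_rfl).1
    have step1 : (hexGraph.induce S).Reachable ⟨fj j (r + n), hmid⟩ ⟨fj (j - 1) (r + n + 1), e1⟩ :=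
      reach_of_adj S hmid e1 (by simpa [add_assoc] using adj_fj_up hj (r + n))
    have step2 : (hexGraph.induce S).Reachable ⟨fj (j - 1) (r + n + 1), e1⟩ ⟨fj j (r + n + 1), e2⟩ := by
      have := reach_of_adj S e1 e2 (by simpa using adj_fj_succ (j - 1) (r + n + 1))
      exact this
    have e : fj j (r + (n + 1 : ℕ)) = fj j (r + n + 1) := by push_cast; rw [add_assoc]
    rw [show (⟨fj j (r + (n + 1 : ℕ)), _⟩ : S) = ⟨fj j (r + n + 1), e2⟩ from Subtype.ext e]
    exact step1.trans step2

end Reach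


end Summit.CriticalPhenomena.SAWScalingLimit.Theorems.BoundaryClosure.Negative
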